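import Summits.MatrixMultiplication.MatrixMultiplication.Theorems.FarEdgeDescentAnchorIndependence
import Summits.MatrixMultiplication.MatrixMultiplication.Theorems.FarEdgeDescentAnchorValue
import Summits.MatrixMultiplication.MatrixMultiplication.Theorems.FarEdgeDescentTameProfile
import HarnessLib

/-!
# Route `FarEdgeDescent` — ANCHOR INDEPENDENCE II: the upward law placed — NEC, tame-regime theorem,
# not a shape law, insufficient next to the special leaf, and EXACTLY the quotient aside / crux
(lens-2 «special vs generic», gen 43, Kernel XVIII; support module for the crux `AnchoredLogConvexity`
stmt-MatrixMultiplication-28900; sequel of `FarEdgeDescentAnchorIndependence`; def-free; cut of record UNCHANGED)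

`e(x) := ω(1,x,1) − (x+1)`, `L(a) : ∀ m > a, e(m)² ≤ e(a)·e(2m−a)` (inline), `L(1) = AnchoredLogConvexity`,
`AnchoredUpward : ∀ a ≤ b, L(a) ⟹ L(b)` (memo U12 / N17).

* §3 FOR THE TRUE EXPONENTS (pure logic over tree theorems): `RealLogConvexity ⟺ ∀ a ≥ 1, L(a)
  ⟺ AnchoredLogConvexity ∧ AnchoredUpward(far anchors)` (`realLogConvexity_iff_allAnchors`,
  `realLogConvexity_iff_crux_and_upward`) — the upward law IS the quotient aside 28902 / crux 28900; it is
  NECESSARY, `ω = 2 ⟹ (L(a) ⟹ L(b))` for all real `a ≤ b` (`anchoredUpward_of_mm`); and it is a THEOREM OF THE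
  TAME REGIME, `TameProfile ⟹ AnchoredUpward` (`anchoredUpward_of_tameProfile`: tame ⟹ special leaf ⟹ onset dial).
* §4 READINGS over the two worlds of `FarEdgeDescentAnchorIndependence`.  (XVIII-a) `cruxShape_without_asideShape`:
  a lawful world with `AnchoredLogConvexity`-shape and WITHOUT `RealLogConvexity`-shape — the first world of the
  lineage separating the crux from its aside (in the harmonic, exponential and summable worlds both hold; in the
  kink worlds both fail): modulo the shape laws the aside is STRICTLY stronger, by exactly the upward law.
  (XVIII-b) `anchoredFamily_incomparable`: for all `1 ≤ a < b` NEITHER `L(a) ⟹ L(b)` NOR `L(b) ⟹ L(a)` is a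
  shape law — the far members of the family are pairwise incomparable; `truthSet_hole`: `1 ∈ T`, `2 ∉ T`,
  `[5/2,∞) ⊆ T` in one lawful world.  (XVIII-c) `anchoredUpward_insufficient`: special-leaf shape ∧ upward law ∧
  `W(1,1,1) > 2` — the upward law cannot replace the crux next to `FiniteSaturation`.

STATUS OF U12 (dichotomy reading): NEC · a theorem of the special / tame regime, generically false among the
shape laws (its failure needs curvature: a chord glued into a strictly convex excess) · WEAKER than the aside
and insufficient next to the special leaf · `crux ∧ U12 = aside`.  Its content for the true profile is therefore
tensor-side, like the crux itself (IDEA-NEEDED).  Nothing here proves `ω = 2`; the cut of record is untouched.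
[cite: LottiRomani1983, §2 (p. 174)] [cite: HuangPan1998, §2 eq. (2.5)–(2.8)] [cite: Coppersmith1997, §1]
-/

set_option linter.dupNamespace false

noncomputable section

namespace Summit.MatrixMultiplication.MatrixMultiplication.Theorems.FarEdgeDescentAnchorUpward

open Literature.Computability.AlgebraicComplexity Set
open Summit.MatrixMultiplication.MatrixMultiplication.Theses.FarEdgeDescent
open Summit.MatrixMultiplication.MatrixMultiplication.Theorems.FarEdgeDescentAnchorLaw
open Summit.MatrixMultiplication.MatrixMultiplication.Theorems.FarEdgeDescentAnchorValue
open Summit.MatrixMultiplication.MatrixMultiplication.Theorems.FarEdgeDescentTameProfile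
open Summit.MatrixMultiplication.MatrixMultiplication.Theorems.FarEdgeDescentAnchorIndependence

/-! ## §3 The upward law for the true exponents: the quotient aside / crux, and its necessity -/

/-- `RealLogConvexity` (aside 28902) is exactly the conjunction of ALL far-anchored laws `L(a)`, `a ≥ 1`
(`→`: tree `anchoredLaw_of_realLogConvexity`; `←`: anchor `k − h`, centre `k`). -/
theorem realLogConvexity_iff_allAnchors :
    RealLogConvexity ↔ ∀ a : ℝ, 1 ≤ a → ∀ m : ℝ, a < m →
      (omegaRect ℂ 1 m 1 - (m + 1)) ^ 2 ≤
        (omegaRect ℂ 1 a 1 - (a + 1)) * (omegaRect ℂ 1 (2 * m - a) 1 - (2 * m - a + 1)) := by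
  refine ⟨fun h a ha => anchoredLaw_of_realLogConvexity ha h, fun h k l hl hkl => ?_⟩
  have h' := h (k - l) hkl k (by linarith)
  rw [show 2 * k - (k - l) = k + l by ring] at h'
  exact h'

/-- **`RealLogConvexity ⟺ AnchoredLogConvexity ∧ AnchoredUpward`** (upward law on the far anchors `1 ≤ a ≤ b`):
the member-free upward law is PRECISELY the quotient of the aside 28902 by the crux 28900. -/
theorem realLogConvexity_iff_crux_and_upward :
    RealLogConvexity ↔
      (AnchoredLogConvexity ∧ ∀ a b : ℝ, 1 ≤ a → a ≤ b →
        (∀ m : ℝ, a < m → (omegaRect ℂ 1 m 1 - (m + 1)) ^ 2 ≤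
          (omegaRect ℂ 1 a 1 - (a + 1)) * (omegaRect ℂ 1 (2 * m - a) 1 - (2 * m - a + 1))) →
        ∀ m : ℝ, b < m → (omegaRect ℂ 1 m 1 - (m + 1)) ^ 2 ≤
          (omegaRect ℂ 1 b 1 - (b + 1)) * (omegaRect ℂ 1 (2 * m - b) 1 - (2 * m - b + 1))) := by
  rw [realLogConvexity_iff_allAnchors]
  constructor
  · intro h
    exact ⟨anchoredLaw_one_iff.1 (h 1 le_rfl), fun a b ha hab _ => h b (ha.trans hab)⟩
  · rintro ⟨h1, hup⟩ a ha
    exact hup 1 a le_rfl ha (anchoredLaw_one_iff.2 h1)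

/-- **NECESSITY of the upward law**: under the summit `L(a) ⟹ L(b)` for ALL real anchors `a ≤ b` (for `b ≥ 1`
the conclusion holds by `anchoredLaw_of_mm`; for `b < 1` the hypothesis is refuted by `not_anchoredLaw_of_mm`). -/
theorem anchoredUpward_of_mm (hS : _root_.MatrixMultiplication) {a b : ℝ} (hab : a ≤ b)
    (hL : ∀ m : ℝ, a < m → (omegaRect ℂ 1 m 1 - (m + 1)) ^ 2 ≤
        (omegaRect ℂ 1 a 1 - (a + 1)) * (omegaRect ℂ 1 (2 * m - a) 1 - (2 * m - a + 1))) :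
    ∀ m : ℝ, b < m → (omegaRect ℂ 1 m 1 - (m + 1)) ^ 2 ≤
        (omegaRect ℂ 1 b 1 - (b + 1)) * (omegaRect ℂ 1 (2 * m - b) 1 - (2 * m - b + 1)) := by
  rcases le_or_gt 1 b with hb | hb
  · exact anchoredLaw_of_mm hb hS
  · exact absurd hL (not_anchoredLaw_of_mm (lt_of_le_of_lt hab hb) hS)

/-- **The upward law in the TAME (polytope) regime of the true profile**: `TameProfile ⟹ (L(a) ⟹ L(b))` for
all real `a ≤ b` — a tame far profile has a last kink (`finiteSaturation_of_tameProfile`), and next to the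
special leaf the family is the onset dial (`anchoredLaw_mono_of_finiteSaturation`).  With `bentWorld` (a
NON-tame lawful pencil violating the upward law at any prescribed pair of far anchors) this is the lens reading
of U12: the upward law is a theorem of the special / tame regime and fails in the generic / curved one. -/
theorem anchoredUpward_of_tameProfile (hT : TameProfile) {a b : ℝ} (hab : a ≤ b)
    (hL : ∀ m : ℝ, a < m → (omegaRect ℂ 1 m 1 - (m + 1)) ^ 2 ≤
        (omegaRect ℂ 1 a 1 - (a + 1)) * (omegaRect ℂ 1 (2 * m - a) 1 - (2 * m - a + 1))) :
    ∀ m : ℝ, b < m → (omegaRect ℂ 1 m 1 - (m + 1)) ^ 2 ≤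
        (omegaRect ℂ 1 b 1 - (b + 1)) * (omegaRect ℂ 1 (2 * m - b) 1 - (2 * m - b + 1)) :=
  anchoredLaw_mono_of_finiteSaturation (finiteSaturation_of_tameProfile hT) hab hL

/-! ## §4 Readings -/

/-- **KERNEL XVIII-a — the crux does not carry its aside among the shape laws.**  A 3D-lawful `W` with
`AnchoredLogConvexity`-shape, WITHOUT `RealLogConvexity`-shape, without any saturated length, and
`W(1,1,1) = 9/4` (the secant-bent harmonic world at `a = 1`, `b = 2`, chord over `[2, 5/2]`). -/
theorem cruxShape_without_asideShape :
    ∃ W : ℝ → ℝ → ℝ → ℝ,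
      ((∀ x y z : ℝ, W x y z = W y x z ∧ W x y z = W x z y) ∧
        (∀ ν : ℝ, 0 < ν → ∀ x y z : ℝ, 0 < x → 0 < y → 0 < z →
          W (ν * x) (ν * y) (ν * z) = ν * W x y z) ∧
        (∀ x y z x' y' z' : ℝ, 0 < x → 0 < y → 0 < z → 0 < x' → 0 < y' → 0 < z' →
          W (x + x') (y + y') (z + z') ≤ W x y z + W x' y' z') ∧
        (∀ x y y' z : ℝ, 0 < x → 0 < y → y ≤ y' → 0 < z → W x y z ≤ W x y' z) ∧
        (∀ x y z : ℝ, 0 < x → 0 < y → 0 < z →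
          max (x + z) (max (x + y) (y + z)) ≤ W x y z ∧ W x y z ≤ x + y + z)) ∧
      (∀ m : ℝ, 1 < m → (W 1 m 1 - (m + 1)) ^ 2 ≤ (W 1 1 1 - 2) * (W 1 (2 * m - 1) 1 - 2 * m)) ∧
      (¬ ∀ k h : ℝ, 0 < h → 1 ≤ k - h →
        (W 1 k 1 - (k + 1)) ^ 2 ≤ (W 1 (k - h) 1 - (k - h + 1)) * (W 1 (k + h) 1 - (k + h + 1))) ∧
      (¬ ∃ K : ℕ, 2 ≤ K ∧ W 1 K 1 = K + 1) ∧
      W 1 1 1 = 9 / 4 := by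
  obtain ⟨W, hlaws, -, hone, hstrict, hL1, hnot2, -⟩ := bentWorld (a := 1) (b := 2) le_rfl (by norm_num)
  refine ⟨W, hlaws, ?_, ?_, ?_, hone⟩
  · intro m hm
    have h := hL1 m hm
    rw [show ((1 : ℝ) + 1) = 2 by norm_num, show (2 * m - 1 + 1 : ℝ) = 2 * m by ring] at h
    exact h
  · intro hR
    apply hnot2
    intro m hm
    have h := hR m (m - 2) (by linarith) (by linarith)
    rw [show m - (m - 2) = 2 by ring, show m + (m - 2) = 2 * m - 2 by ring] at h
    exact h
  · rintro ⟨K, hK, hsat⟩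
    have hK1 : (1 : ℝ) ≤ K := by exact_mod_cast (by omega : 1 ≤ K)
    have := hstrict K hK1
    linarith

/-- **KERNEL XVIII-b — the far members of the anchored family are pairwise INCOMPARABLE modulo the shape
laws.**  For all `1 ≤ a < b`: a lawful world with `L(a) ∧ ¬L(b)` (value `9/4`) and a lawful world with
`L(b) ∧ ¬L(a)` (value `> 2`).  Neither `AnchoredUpward` nor its converse is a shape law. -/
theorem anchoredFamily_incomparable {a b : ℝ} (ha : 1 ≤ a) (hab : a < b) :
    (∃ W : ℝ → ℝ → ℝ → ℝ,
      ((∀ x y z : ℝ, W x y z = W y x z ∧ W x y z = W x z y) ∧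
        (∀ ν : ℝ, 0 < ν → ∀ x y z : ℝ, 0 < x → 0 < y → 0 < z →
          W (ν * x) (ν * y) (ν * z) = ν * W x y z) ∧
        (∀ x y z x' y' z' : ℝ, 0 < x → 0 < y → 0 < z → 0 < x' → 0 < y' → 0 < z' →
          W (x + x') (y + y') (z + z') ≤ W x y z + W x' y' z') ∧
        (∀ x y y' z : ℝ, 0 < x → 0 < y → y ≤ y' → 0 < z → W x y z ≤ W x y' z) ∧
        (∀ x y z : ℝ, 0 < x → 0 < y → 0 < z →
          max (x + z) (max (x + y) (y + z)) ≤ W x y z ∧ W x y z ≤ x + y + z)) ∧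
      (∀ m : ℝ, a < m →
        (W 1 m 1 - (m + 1)) ^ 2 ≤ (W 1 a 1 - (a + 1)) * (W 1 (2 * m - a) 1 - (2 * m - a + 1))) ∧
      (¬ ∀ m : ℝ, b < m →
        (W 1 m 1 - (m + 1)) ^ 2 ≤ (W 1 b 1 - (b + 1)) * (W 1 (2 * m - b) 1 - (2 * m - b + 1))) ∧
      W 1 1 1 = 9 / 4) ∧
    (∃ W : ℝ → ℝ → ℝ → ℝ,
      ((∀ x y z : ℝ, W x y z = W y x z ∧ W x y z = W x z y) ∧
        (∀ ν : ℝ, 0 < ν → ∀ x y z : ℝ, 0 < x → 0 < y → 0 < z →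
          W (ν * x) (ν * y) (ν * z) = ν * W x y z) ∧
        (∀ x y z x' y' z' : ℝ, 0 < x → 0 < y → 0 < z → 0 < x' → 0 < y' → 0 < z' →
          W (x + x') (y + y') (z + z') ≤ W x y z + W x' y' z') ∧
        (∀ x y y' z : ℝ, 0 < x → 0 < y → y ≤ y' → 0 < z → W x y z ≤ W x y' z) ∧
        (∀ x y z : ℝ, 0 < x → 0 < y → 0 < z →
          max (x + z) (max (x + y) (y + z)) ≤ W x y z ∧ W x y z ≤ x + y + z)) ∧
      (∀ m : ℝ, b < m →
        (W 1 m 1 - (m + 1)) ^ 2 ≤ (W 1 b 1 - (b + 1)) * (W 1 (2 * m - b) 1 - (2 * m - b + 1))) ∧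
      (¬ ∀ m : ℝ, a < m →
        (W 1 m 1 - (m + 1)) ^ 2 ≤ (W 1 a 1 - (a + 1)) * (W 1 (2 * m - a) 1 - (2 * m - a + 1))) ∧
      2 < W 1 1 1) := by
  refine ⟨?_, ?_⟩
  · obtain ⟨W, hlaws, -, hone, -, hLa, hnLb, -⟩ := bentWorld ha hab
    exact ⟨W, hlaws, hLa, hnLb, hone⟩
  · obtain ⟨W, hlaws, -, hup, hdown, hone⟩ := kinkWorld (lt_of_le_of_lt ha hab)
    refine ⟨W, hlaws, hup b le_rfl, hdown a ha hab, ?_⟩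
    rw [hone]
    have : 0 < (b - 1) / (b + 2) := div_pos (by linarith) (by linarith)
    linarith

/-- **The truth set can have a HOLE.**  A lawful world in which `L(1)` holds, `L(2)` fails and `L(a')` holds
for every `a' ≥ 5/2`: the truth set of the anchored family on the far anchors is neither an up-set nor an
interval (secant-bent harmonic world, chord over `[2, 5/2]`). -/
theorem truthSet_hole :
    ∃ W : ℝ → ℝ → ℝ → ℝ,
      ((∀ x y z : ℝ, W x y z = W y x z ∧ W x y z = W x z y) ∧
        (∀ ν : ℝ, 0 < ν → ∀ x y z : ℝ, 0 < x → 0 < y → 0 < z →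
          W (ν * x) (ν * y) (ν * z) = ν * W x y z) ∧
        (∀ x y z x' y' z' : ℝ, 0 < x → 0 < y → 0 < z → 0 < x' → 0 < y' → 0 < z' →
          W (x + x') (y + y') (z + z') ≤ W x y z + W x' y' z') ∧
        (∀ x y y' z : ℝ, 0 < x → 0 < y → y ≤ y' → 0 < z → W x y z ≤ W x y' z) ∧
        (∀ x y z : ℝ, 0 < x → 0 < y → 0 < z →
          max (x + z) (max (x + y) (y + z)) ≤ W x y z ∧ W x y z ≤ x + y + z)) ∧
      (∀ m : ℝ, 1 < m →
        (W 1 m 1 - (m + 1)) ^ 2 ≤ (W 1 1 1 - (1 + 1)) * (W 1 (2 * m - 1) 1 - (2 * m - 1 + 1))) ∧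
      (¬ ∀ m : ℝ, 2 < m →
        (W 1 m 1 - (m + 1)) ^ 2 ≤ (W 1 2 1 - (2 + 1)) * (W 1 (2 * m - 2) 1 - (2 * m - 2 + 1))) ∧
      (∀ a' : ℝ, 5 / 2 ≤ a' → ∀ m : ℝ, a' < m →
        (W 1 m 1 - (m + 1)) ^ 2 ≤ (W 1 a' 1 - (a' + 1)) * (W 1 (2 * m - a') 1 - (2 * m - a' + 1))) ∧
      W 1 1 1 = 9 / 4 := by
  obtain ⟨W, hlaws, -, hone, -, hL1, hnot2, htail⟩ := bentWorld (a := 1) (b := 2) le_rfl (by norm_num)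
  refine ⟨W, hlaws, hL1, hnot2, fun a' ha' => htail a' (by norm_num; linarith), hone⟩

/-- **KERNEL XVIII-c — the upward law cannot replace the crux next to the special leaf.**  For every `b > 1`
a lawful world with `FiniteSaturation`-shape, the upward law on ALL far anchors (`1 ≤ a ≤ a'`), and
`W(1,1,1) > 2` (the kink world: truth set `[b,∞)`). -/
theorem anchoredUpward_insufficient {b : ℝ} (hb : 1 < b) :
    ∃ W : ℝ → ℝ → ℝ → ℝ,
      ((∀ x y z : ℝ, W x y z = W y x z ∧ W x y z = W x z y) ∧
        (∀ ν : ℝ, 0 < ν → ∀ x y z : ℝ, 0 < x → 0 < y → 0 < z →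
          W (ν * x) (ν * y) (ν * z) = ν * W x y z) ∧
        (∀ x y z x' y' z' : ℝ, 0 < x → 0 < y → 0 < z → 0 < x' → 0 < y' → 0 < z' →
          W (x + x') (y + y') (z + z') ≤ W x y z + W x' y' z') ∧
        (∀ x y y' z : ℝ, 0 < x → 0 < y → y ≤ y' → 0 < z → W x y z ≤ W x y' z) ∧
        (∀ x y z : ℝ, 0 < x → 0 < y → 0 < z →
          max (x + z) (max (x + y) (y + z)) ≤ W x y z ∧ W x y z ≤ x + y + z)) ∧
      (∃ K : ℕ, 2 ≤ K ∧ W 1 K 1 = K + 1) ∧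
      (∀ a a' : ℝ, 1 ≤ a → a ≤ a' →
        (∀ m : ℝ, a < m →
          (W 1 m 1 - (m + 1)) ^ 2 ≤ (W 1 a 1 - (a + 1)) * (W 1 (2 * m - a) 1 - (2 * m - a + 1))) →
        ∀ m : ℝ, a' < m →
          (W 1 m 1 - (m + 1)) ^ 2 ≤ (W 1 a' 1 - (a' + 1)) * (W 1 (2 * m - a') 1 - (2 * m - a' + 1))) ∧
      2 < W 1 1 1 := by
  obtain ⟨W, hlaws, hfin, hup, hdown, hone⟩ := kinkWorld hb
  refine ⟨W, hlaws, hfin, fun a a' ha haa' hLa => ?_, ?_⟩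
  · rcases le_or_gt b a with hba | hab
    · exact hup a' (hba.trans haa')
    · exact absurd hLa (hdown a ha hab)
  · rw [hone]
    have : 0 < (b - 1) / (b + 2) := div_pos (by linarith) (by linarith)
    linarith

end Summit.MatrixMultiplication.MatrixMultiplication.Theorems.FarEdgeDescentAnchorUpward

end
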